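import Summits.ValiantsHypothesis.ValiantsHypothesis.Theorems.BarrierLeverAnchoredDoorHitsLowerPairsDecrementCertificate

/-!
# Support item `AnchoredDoorHitsLowerPairs` (stmt-ValiantsHypothesis-22510), line `anchored-peeling`:
# CONJECTURE DC (typed) — the canonical residual family `(R_a, K_{2^a−1})` is hit at profile 1

Helper file (`--supports stmt-ValiantsHypothesis-22510`; cell valiant-natproofs, rung V4, 𝒟-side door (c); registered line
`Cruxes/AnchoredDoorHitsLowerPairs/Lines/anchored_peeling.lean` v19 (registered residual `Stmt.stub_ltRest`); planner ask (B) of STATUS 2026-08-28T15:24:35Z;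
prover seat val-np-p1 gen 22; memo HOME/val-np-p1/g22/MEMO-relapex-valnp1-g22.md §5, §12). Closes NO item. STATEMENT ONLY (one `def … : Prop`), offered to
the planner as the typed form of «the canonical family as a theorem»: the kernel instances `Dec2/Dec3/Dec4.symbolicDet_one_ne_zero` (`…DecrementCertificate`,
p650128) and `R4K15.…`, `R3K7.…` are its cases `k = 1, 2, 3` for particular enumerations; the DECREMENT CERTIFICATE (memo §12) is an LT certificate for
`k ≤ 6` (`r ≤ 8129`, exact check) and is conjectured to be one for every `k` — which would prove this statement in every characteristic.

THE FAMILY in coordinates: `x`-variables `0..k−1` (= `A`), `k` (= `α`), `k+1..2k` (= `B'`); the rows are the faces of the cube on these `2k+1` variables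
that are NOT strict supersets of `A ∪ {α}` containing a `B'`-variable (i.e. all faces except `A∪α∪Q`, `Q ≠ ∅`); the columns are the faces of size `≤ 2` of the
simplex on the `2^{k+1} − 1` vertices `0..2^{k+1}−2` (the complete graph `K_{2^{k+1}−1}` as a one-dimensional complex). Sizes agree:
`2^{2k+1} − 2^k + 1 = 1 + (2^{k+1}−1) + C(2^{k+1}−1, 2)`. For `k ≥ 3` these pairs carry NO face-UQ data at profile 1 (memo §1/§5): they are members of the
residual of every registered composition of this line, reached by no apex split (`k = 2`: exhaustive).

WHAT THIS IS NOT: a proof; nothing on crux stmt-ValiantsHypothesis-14610 or on `VP` versus `VNP`.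
-/

set_option linter.dupNamespace false

namespace Summit.ValiantsHypothesis.ValiantsHypothesis.Theorems.BarrierLever.AnchoredPeeling

/-- A row of the canonical pair at level `k`: a face of the cube on the variables `0..2k` other than `A ∪ {α} ∪ Q` with `Q ≠ ∅`
(`A` = variables `< k`, `α` = variable `k`, `Q ⊆` variables `k+1..2k`). -/
def DecRow (k h : ℕ) (U : Finset (Fin h)) : Prop :=
  (∀ x ∈ U, x.val ≤ 2 * k) ∧ ¬ ((∀ i : Fin h, i.val ≤ k → i ∈ U) ∧ ∃ x ∈ U, k < x.val)

/-- A column of the canonical pair at level `k`: a face of size `≤ 2` of the simplex on the vertices `0..2^{k+1} − 2` (the complete graph `K_{2^{k+1}−1}`). -/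
def DecCol (k h : ℕ) (W : Finset (Fin h)) : Prop :=
  (∀ y ∈ W, y.val + 1 < 2 ^ (k + 1)) ∧ W.card ≤ 2

/-- **CONJECTURE DC (typed; OFFERED stub text): the canonical residual family is hit at profile 1.** For every `k ≥ 1` and every injective enumeration
`(u, w)` of the rows `DecRow k h` and columns `DecCol k h` (in an ambient `Fin h` large enough for both), the profile-1 symbolic minor is nonzero.
Instances `k = 1, 2, 3` (particular enumerations): `Dec2/Dec3/Dec4.symbolicDet_one_ne_zero`; evidence `k ≤ 6`: the decrement certificate (memo §12). -/
def Stmt.stub_decrementFamily : Prop :=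
  ∀ (k h r : ℕ) (u w : Fin r → Finset (Fin h)), 1 ≤ k → 2 * k + 1 ≤ h → 2 ^ (k + 1) - 1 ≤ h →
    Function.Injective u → Function.Injective w →
    (∀ U : Finset (Fin h), U ∈ Set.range u ↔ DecRow k h U) → (∀ W : Finset (Fin h), W ∈ Set.range w ↔ DecCol k h W) →
    symbolicDet 1 h r u w ≠ 0

end Summit.ValiantsHypothesis.ValiantsHypothesis.Theorems.BarrierLever.AnchoredPeeling
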